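import Mathlib
import Summits.Ventures.PercRepro2.CrossBGen

/-!
# Theorem (B) with a hitting set in the `v`-slot as well
(blind cell PercRepro2, p5 g28; `proofs/P5-OEDGE.md` §37)

`CrossBGen.lean` generalises theorem (B) of row (LEAF-½) to arbitrary up-sets in the `o`- and
`b`-slots. The `v`-slot generalises too: for a finite vertex set `S`, with the hitting event
`X_S = {a₂ ↔ S} = (a₂ ↮ S)ᶜ`, the avoidance `{a₂ ↮ a₁} ∩ {a₂ ↮ S} = {a₂ ↮ {a₁} ∪ S}` is again a
set avoidance (BHK06 Thm 1.4 under avoidance: `bhk_cross_cluster_avoid` with `X = insert a₁ S`),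
and `X_S` is an increasing cluster event (`hitEvent_eq_clusterInEvent`), so the three inputs and the
certificate of `crossB_nonneg` go through verbatim:

  `crossBGen_nonneg_set : 0 ≤ crossBGen p ends a₁ a₂ (avoidAll ends a₂ S)ᶜ (clusterInEvent ends a₂ 𝓗) (clusterInEvent ends a₁ 𝓛)`.

CONTRAST (p5 g28, census): the full «G2» grouping `groupL ≥ 0` — the candidate of record for the
row — survives hitting sets in the `o`- and `b`-slots but is FALSE for a hitting pair `{v, w}` in
the `v`-slot (exact witness at `n = 6`, `mining/p5/g28/`); so of the two summands
`groupL = crossA + crossB`, only the theorem `crossB ≥ 0` is indifferent to the `v`-slot's shape,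
and the single vertex `v` is what the open `(A)`-term needs.
-/

namespace Summit.Ventures.PercRepro2

open UnionCluster CovForm PendantRoot LeafStep LeafHalfCross CrossBGen

namespace CrossBGenSet

variable {V : Type*} {E : Type*} [Fintype E] [DecidableEq E] [Fintype V] [DecidableEq V]
  {R : Type*} [Field R] [LinearOrder R] [IsStrictOrderedRing R]

variable (p : E → R) (ends : E → Sym2 V)

/-! ## The hitting event and the set avoidance -/

section Events

omit [Fintype E] [DecidableEq E] [Fintype V] [DecidableEq V] in
/-- `{a₂ ↔ S}` is the cluster event `{K | ∃ s ∈ S, s ∈ K}` of `C₂`. -/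
lemma hitEvent_eq_clusterInEvent (a₂ : V) (S : Finset V) :
    (avoidAll ends a₂ S)ᶜ = clusterInEvent ends a₂ {K | ∃ s ∈ S, s ∈ K} := by
  ext ω
  simp only [Set.mem_compl_iff, mem_avoidAll, mem_clusterInEvent, Set.mem_setOf_eq, mem_cluster,
    not_forall, not_not]
  exact ⟨fun ⟨s, hs, h⟩ => ⟨s, hs, h⟩, fun ⟨s, hs, h⟩ => ⟨s, hs, h⟩⟩

omit [Fintype E] [DecidableEq E] [Fintype V] [DecidableEq V] in
/-- The hitting family is an up-set. -/
lemma isUpperSet_hit (S : Finset V) : IsUpperSet {K : Set V | ∃ s ∈ S, s ∈ K} :=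
  fun _ _ h ⟨s, hs, hK⟩ => ⟨s, hs, h hK⟩

omit [Fintype E] [DecidableEq E] [Fintype V] in
/-- `{a₂ ↮ {a₁} ∪ S} = Q ∩ {a₂ ↮ S}`. -/
lemma avoidAll_insert_eq (a₁ a₂ : V) (S : Finset V) :
    avoidAll ends a₂ (insert a₁ S) = avoidAll ends a₂ {a₁} ∩ avoidAll ends a₂ S := by
  ext ω
  simp only [mem_avoidAll, Finset.mem_insert, forall_eq_or_imp, Set.mem_inter_iff,
    Finset.mem_singleton, forall_eq]

omit [Fintype V] [LinearOrder R] [IsStrictOrderedRing R] in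
/-- Masses under the set avoidance: `P(Y, a₂ ↮ {a₁} ∪ S) = P(Q, Y) − P(Q, X_S, Y)`. -/
lemma prob_inter_avoidAll_insert (Y : Set (Config E)) (a₁ a₂ : V) (S : Finset V) :
    prob p (Y ∩ avoidAll ends a₂ (insert a₁ S)) =
      prob p (avoidAll ends a₂ {a₁} ∩ Y) -
        prob p (avoidAll ends a₂ {a₁} ∩ ((avoidAll ends a₂ S)ᶜ ∩ Y)) := by
  rw [avoidAll_insert_eq]
  have h := prob_inter_add_prob_inter_compl p (avoidAll ends a₂ {a₁} ∩ Y) (avoidAll ends a₂ S)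
  have e1 : Y ∩ (avoidAll ends a₂ {a₁} ∩ avoidAll ends a₂ S) =
      avoidAll ends a₂ {a₁} ∩ Y ∩ avoidAll ends a₂ S := by
    ext ω; simp only [Set.mem_inter_iff]; tauto
  have e2 : avoidAll ends a₂ {a₁} ∩ Y ∩ (avoidAll ends a₂ S)ᶜ =
      avoidAll ends a₂ {a₁} ∩ ((avoidAll ends a₂ S)ᶜ ∩ Y) := by
    ext ω; simp only [Set.mem_inter_iff, Set.mem_compl_iff]; tauto
  rw [e1, ← e2]
  linear_combination h

omit [Fintype V] [LinearOrder R] [IsStrictOrderedRing R] in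
/-- `P(a₂ ↮ {a₁} ∪ S) = P(Q) − P(Q, X_S)`. -/
lemma prob_avoidAll_insert (a₁ a₂ : V) (S : Finset V) :
    prob p (avoidAll ends a₂ (insert a₁ S)) =
      prob p (avoidAll ends a₂ {a₁}) - prob p (avoidAll ends a₂ {a₁} ∩ (avoidAll ends a₂ S)ᶜ) := by
  have h := prob_inter_avoidAll_insert p ends Set.univ a₁ a₂ S
  simpa only [Set.univ_inter, Set.inter_univ] using h

end Events

/-! ## The three inputs -/

section Inputs

variable {𝓗 𝓛 : Set (Set V)}

/-- **BHK06 Thm 1.4 under the set avoidance `{a₂ ↮ {a₁} ∪ S}`**, in `Q`-masses. -/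
theorem cross_set_avoid (hp : IsProbVec p) (a₁ a₂ : V) (S : Finset V) (h𝓗 : IsUpperSet 𝓗)
    (h𝓛 : IsUpperSet 𝓛) :
    (prob p (avoidAll ends a₂ {a₁} ∩ (clusterInEvent ends a₂ 𝓗 ∩ clusterInEvent ends a₁ 𝓛)) -
        prob p (avoidAll ends a₂ {a₁} ∩
          ((avoidAll ends a₂ S)ᶜ ∩ (clusterInEvent ends a₂ 𝓗 ∩ clusterInEvent ends a₁ 𝓛)))) *
      (prob p (avoidAll ends a₂ {a₁}) -
        prob p (avoidAll ends a₂ {a₁} ∩ (avoidAll ends a₂ S)ᶜ)) ≤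
    (prob p (avoidAll ends a₂ {a₁} ∩ clusterInEvent ends a₂ 𝓗) -
        prob p (avoidAll ends a₂ {a₁} ∩ ((avoidAll ends a₂ S)ᶜ ∩ clusterInEvent ends a₂ 𝓗))) *
      (prob p (avoidAll ends a₂ {a₁} ∩ clusterInEvent ends a₁ 𝓛) -
        prob p (avoidAll ends a₂ {a₁} ∩ ((avoidAll ends a₂ S)ᶜ ∩ clusterInEvent ends a₁ 𝓛))) := by
  have h := bhk_cross_cluster_avoid p hp ends a₂ a₁ (X := insert a₁ S) (Finset.mem_insert_self a₁ S)
    h𝓗 h𝓛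
  rw [prob_inter_avoidAll_insert, prob_inter_avoidAll_insert, prob_inter_avoidAll_insert,
    prob_avoidAll_insert] at h
  exact h

/-- **BHK06 Thm 1.4 under `Q`, cleared**, for `a₂ ↔ S` against an up-set `𝓛` of `C₁`. -/
theorem anticov_nonneg_set (hp : IsProbVec p) (a₁ a₂ : V) (S : Finset V) (h𝓛 : IsUpperSet 𝓛) :
    0 ≤ anticov p ends a₁ a₂ (avoidAll ends a₂ S)ᶜ (clusterInEvent ends a₁ 𝓛) := by
  have h := bhk_cross_cluster p hp ends a₁ a₂ h𝓛 (isUpperSet_hit S)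
  rw [← hitEvent_eq_clusterInEvent, ← avoidAll_eq_compl] at h
  have e1 : clusterInEvent ends a₁ 𝓛 ∩ avoidAll ends a₂ {a₁} =
      avoidAll ends a₂ {a₁} ∩ clusterInEvent ends a₁ 𝓛 := Set.inter_comm _ _
  have e2 : (avoidAll ends a₂ S)ᶜ ∩ avoidAll ends a₂ {a₁} =
      avoidAll ends a₂ {a₁} ∩ (avoidAll ends a₂ S)ᶜ := Set.inter_comm _ _
  have e3 : clusterInEvent ends a₁ 𝓛 ∩ (avoidAll ends a₂ S)ᶜ ∩ avoidAll ends a₂ {a₁} =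
      avoidAll ends a₂ {a₁} ∩ ((avoidAll ends a₂ S)ᶜ ∩ clusterInEvent ends a₁ 𝓛) := by
    rw [Set.inter_comm, Set.inter_comm (clusterInEvent ends a₁ 𝓛)]
  rw [e1, e2, e3] at h
  unfold anticov
  linarith

/-- **BHK06 Thm 1.1 under `Q`** for `a₂ ↔ S` and an up-set `𝓗` of `C₂`, in `Q`-masses. -/
theorem same_cluster_set (hp : IsProbVec p) (a₁ a₂ : V) (S : Finset V) (h𝓗 : IsUpperSet 𝓗) :
    prob p (avoidAll ends a₂ {a₁} ∩ (avoidAll ends a₂ S)ᶜ) *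
        prob p (avoidAll ends a₂ {a₁} ∩ clusterInEvent ends a₂ 𝓗) ≤
      prob p (avoidAll ends a₂ {a₁} ∩ ((avoidAll ends a₂ S)ᶜ ∩ clusterInEvent ends a₂ 𝓗)) *
        prob p (avoidAll ends a₂ {a₁}) := by
  have h := bhk_same_cluster_events p hp ends a₂ a₁ (isUpperSet_hit S) h𝓗
  rw [← hitEvent_eq_clusterInEvent, ← Q_eq_compl_conn] at h
  have e1 : (avoidAll ends a₂ S)ᶜ ∩ avoidAll ends a₂ {a₁} =
      avoidAll ends a₂ {a₁} ∩ (avoidAll ends a₂ S)ᶜ := Set.inter_comm _ _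
  have e2 : clusterInEvent ends a₂ 𝓗 ∩ avoidAll ends a₂ {a₁} =
      avoidAll ends a₂ {a₁} ∩ clusterInEvent ends a₂ 𝓗 := Set.inter_comm _ _
  have e3 : (avoidAll ends a₂ S)ᶜ ∩ clusterInEvent ends a₂ 𝓗 ∩ avoidAll ends a₂ {a₁} =
      avoidAll ends a₂ {a₁} ∩ ((avoidAll ends a₂ S)ᶜ ∩ clusterInEvent ends a₂ 𝓗) :=
    Set.inter_comm _ _
  rw [e1, e2, e3] at h
  exact h

end Inputs

/-! ## The theorem -/

/-- **THEOREM (B) with a hitting set `S` in the `v`-slot and up-sets in the other two.** -/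
theorem crossBGen_nonneg_set (hp : IsProbVec p) (a₁ a₂ : V) (S : Finset V) {𝓗 𝓛 : Set (Set V)}
    (h𝓗 : IsUpperSet 𝓗) (h𝓛 : IsUpperSet 𝓛) :
    0 ≤ crossBGen p ends a₁ a₂ (avoidAll ends a₂ S)ᶜ (clusterInEvent ends a₂ 𝓗)
      (clusterInEvent ends a₁ 𝓛) := by
  have hF1 := cross_set_avoid p ends hp a₁ a₂ S h𝓗 h𝓛
  have hF2 := anticov_nonneg_set p ends hp a₁ a₂ S h𝓛
  have hF3 := same_cluster_set p ends hp a₁ a₂ S h𝓗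
  unfold crossBGen
  unfold anticov at hF2 ⊢
  set Q := prob p (avoidAll ends a₂ {a₁}) with hQ
  set B := prob p (avoidAll ends a₂ {a₁} ∩ clusterInEvent ends a₁ 𝓛) with hB
  set O := prob p (avoidAll ends a₂ {a₁} ∩ clusterInEvent ends a₂ 𝓗) with hO
  set Vm := prob p (avoidAll ends a₂ {a₁} ∩ (avoidAll ends a₂ S)ᶜ) with hV
  set BO := prob p (avoidAll ends a₂ {a₁} ∩
    (clusterInEvent ends a₂ 𝓗 ∩ clusterInEvent ends a₁ 𝓛)) with hBO
  set BV := prob p (avoidAll ends a₂ {a₁} ∩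
    ((avoidAll ends a₂ S)ᶜ ∩ clusterInEvent ends a₁ 𝓛)) with hBV
  set VO := prob p (avoidAll ends a₂ {a₁} ∩
    ((avoidAll ends a₂ S)ᶜ ∩ clusterInEvent ends a₂ 𝓗)) with hVO
  set BVO := prob p (avoidAll ends a₂ {a₁} ∩
    ((avoidAll ends a₂ S)ᶜ ∩ (clusterInEvent ends a₂ 𝓗 ∩ clusterInEvent ends a₁ 𝓛))) with hBVO
  have hs1 : 0 ≤ (O - VO) * (B - BV) - (BO - BVO) * (Q - Vm) := by linarith
  have hs2 : 0 ≤ Vm * B - Q * BV := hF2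
  have hs3 : 0 ≤ Q * VO - O * Vm := by linarith
  have hW : 0 ≤ Q - Vm := by
    rw [← prob_avoidAll_insert]; exact prob_nonneg hp _
  have hBp : B - BV ≤ Q - Vm := by
    rw [← prob_avoidAll_insert, ← prob_inter_avoidAll_insert]
    exact prob_mono hp Set.inter_subset_right
  have hOp : O - VO ≤ Q - Vm := by
    rw [← prob_avoidAll_insert, ← prob_inter_avoidAll_insert]
    exact prob_mono hp Set.inter_subset_right
  have hBOp : BO - BVO ≤ Q - Vm := by
    rw [← prob_avoidAll_insert, ← prob_inter_avoidAll_insert]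
    exact prob_mono hp Set.inter_subset_right
  have key : (Q - Vm) * (Q * (O * B - Q * BO) + O * (Vm * B - Q * BV) -
      (Q * B * VO - Q ^ 2 * BVO)) =
      Q ^ 2 * ((O - VO) * (B - BV) - (BO - BVO) * (Q - Vm)) +
        (Vm * B - Q * BV) * (Q * VO - O * Vm) := by
    ring
  rcases lt_or_eq_of_le hW with hWpos | hWzero
  · by_contra hneg
    have hneg' := lt_of_not_ge hneg
    have : (Q - Vm) * (Q * (O * B - Q * BO) + O * (Vm * B - Q * BV) -
        (Q * B * VO - Q ^ 2 * BVO)) < 0 := mul_neg_of_pos_of_neg hWpos hneg'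
    nlinarith [mul_nonneg (sq_nonneg Q) hs1, mul_nonneg hs2 hs3]
  · have hBp0 : 0 ≤ B - BV := by
      rw [← prob_inter_avoidAll_insert]; exact prob_nonneg hp _
    have hOp0 : 0 ≤ O - VO := by
      rw [← prob_inter_avoidAll_insert]; exact prob_nonneg hp _
    have hBOp0 : 0 ≤ BO - BVO := by
      rw [← prob_inter_avoidAll_insert]; exact prob_nonneg hp _
    have e1 : B = BV := by linarith
    have e2 : O = VO := by linarith
    have e3 : BO = BVO := by linarith
    have e4 : Vm = Q := by linarith
    rw [e1, e2, e3, e4]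
    ring_nf
    exact le_refl _

end CrossBGenSet

end Summit.Ventures.PercRepro2
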